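import Literature.NumberTheory.DiophantineGeometry.TateAlgorithmUnramifiedTransportProofs
import HarnessLib

/-!
# Tate's algorithm along an unramified homomorphism of DVRs: the `Iₙ*` sub-procedure

Topic `NumberTheory/DiophantineGeometry` (companion proof file of
`Literature.NumberTheory.DiophantineGeometry.TateAlgorithm`; theorems only).  Second file of the
discharge of the named fact
`Literature.NumberTheory.DiophantineGeometry.kodairaSymbolAt_baseChange_of_ramificationIdx_eq_one`
(Silverman *AEC* Prop. VII.5.4 (a): Tate's algorithm is insensitive to unramified base change).

For a ring homomorphism of DVRs `f : R₁ →+* R₂` with `f π₁ = w π₂` (`w ∈ R₂ˣ`) and perfect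
residue fields on both sides, the `Iₙ*` sub-procedure of step 7 of Silverman ATAEC IV.9.4
(`istarIndexAux`, `istarIndex` of `TateAlgorithm`) returns the same index on a model `W` over
`R₁` and on any `u = 1` change `E • (W.map f)` over `R₂` normalised for the same round:
`istarIndexAux_hom_eq` (coupled induction on the fuel) and `istarIndex_hom_eq`.  The proofs are
those of `istarIndexAux_map_eq` / `istarIndex_map_eq` of `TateAlgorithmRingEquivProofs` with the
ring isomorphism `ψ` replaced by `f`: rigidity (`dvd_r_s_t_of_step7`, `…step7b`) and test
invariance (`distinctRootCount_quadratic₁/₂_smul`) over `R₂`, transport of the tests across `f`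
(`dvd_hom_iff`, `pow_dvd_hom_iff`, `distinctRootCount_quadratic₁/₂_hom`, `addVal_Δ_hom_toNat` of
`TateAlgorithmUnramifiedTransportProofs`), existence of the translations on both sides
(`exists_normalize_istarA/B`, perfect residue fields).

## Prior formalisation in the tree (x11b3-p4 lineage, `Summits/BirchSwinnertonDyer/Rank1Residual/X11b/Three/`)

`KodairaTransportMain.kodairaSymbolOfMinimal_map_of_unif` proves the same DVR-level coupling as
`WeierstrassCurve.kodairaSymbolOfMinimal_map_of_map_uniformizer` (with `[IsLocalHom ψ]` assumed
rather than derived from `hw`); `KodairaTransportFraction.kodairaSymbol_map_of_unif` is the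
fraction-field statement WITH a minimality hypothesis `hmin`; `UnramifiedMinimalDescent
.isMinimal_baseChange_of_frobenius` proves minimality persistence on a finite Galois unramified
layer of local fields by Galois descent of the non-minimality witness (no Tate's algorithm).  The
present Literature-side files exist because a Literature `_holds` cannot import `Summits/…`, and add:
minimality persistence for EVERY ring homomorphism of DVRs with `f π₁ = w π₂` and perfect residue
fields (via Step 11 read forwards), the fraction-field statement without `hmin`, and the discharge
of the registry fact itself at arbitrary Dedekind `A ⊆ B`.

## References

* J. H. Silverman, *Advanced Topics in the Arithmetic of Elliptic Curves*, GTM 151, 1994, IV.9,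
  Tate's algorithm 9.4, Step 7 and its sub-procedure (PDF pp. 345, 351–353); Rem. IV.9.5.
* J. H. Silverman, *The Arithmetic of Elliptic Curves*, GTM 106, 2nd ed. 2009, Prop. VII.5.4 (a).
* J. Tate, *Algorithm for determining the type of a singular fiber in an elliptic pencil*, in
  Modular Functions of One Variable IV, LNM 476, 1975, 33–52 (`TateLNM476`; cited through
  Silverman ATAEC IV.9.4, "(Tate [2])" — the primary is not held on this hub).
-/

open Polynomial IsLocalRing

namespace Literature.NumberTheory.DiophantineGeometry

namespace TateAlgorithm

namespace Unramified

section Coupling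

variable {R₁ R₂ : Type*} [CommRing R₁] [IsDomain R₁] [IsDiscreteValuationRing R₁]
  [CommRing R₂] [IsDomain R₂] [IsDiscreteValuationRing R₂] (f : R₁ →+* R₂)

omit [IsDomain R₁] [IsDiscreteValuationRing R₁] [IsDomain R₂] [IsDiscreteValuationRing R₂] in
/-- If `W' = E • f W`, `W₁ = C • W`, `W₁' = C' • W'` then `W₁' = (C' E (f C)⁻¹) • f W₁`. [folklore] -/
private theorem smul_hom_eq_conj_smul {W W₁ : WeierstrassCurve R₁} {W' W₁' : WeierstrassCurve R₂}
    {E C' : WeierstrassCurve.VariableChange R₂} {C : WeierstrassCurve.VariableChange R₁}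
    (hrel : W' = E • W.map f) (h₁ : W₁ = C • W) (h₁' : W₁' = C' • W') :
    W₁' = (C' * E * (C.map f)⁻¹) • W₁.map f := by
  rw [h₁', hrel, h₁, ← WeierstrassCurve.map_variableChange, mul_smul, mul_smul, inv_smul_smul]

omit [IsDomain R₁] [IsDiscreteValuationRing R₁] [IsDomain R₂] [IsDiscreteValuationRing R₂] in
/-- The coupling changes keep `u = 1`. [folklore] -/
private theorem conj_hom_u_eq_one {E C' : WeierstrassCurve.VariableChange R₂}
    {C : WeierstrassCurve.VariableChange R₁} (hC' : C'.u = 1) (hE : E.u = 1) (hC : C.u = 1) :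
    (C' * E * (C.map f)⁻¹).u = 1 := by
  simp [WeierstrassCurve.VariableChange.mul_def, WeierstrassCurve.VariableChange.inv_def,
    WeierstrassCurve.VariableChange.map, hC', hE, hC]

variable [IsLocalHom f] {w : R₂ˣ}

/-- **The `Iₙ*` sub-procedure across `f`** (coupled induction on the fuel): if `W' = E • f W`
with `E` a `u = 1` change over `R₂` and both `W` (over `R₁`) and `W'` (over `R₂`) are normalised
for the start of round `m`, then `istarIndexAux` returns the same value on both.  Same coupling
as `istarIndexAux_smul_eq`, the base model of the `R₂`-run being compared with the image
`f Wₖ` of the `R₁`-run (rigidity `dvd_r_s_t_of_step7/7b` over `R₂`, test invariance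
`distinctRootCount_quadratic₁/₂_smul` over `R₂` and `…_map` across `f`).
Silverman ATAEC IV.9.4, Step 7. [cite: SilvermanATAEC1994, IV.9.4 Step 7] -/
theorem istarIndexAux_hom_eq [PerfectField (ResidueField R₁)] [PerfectField (ResidueField R₂)]
    (hw : f (uniformizer R₁) = ↑w * uniformizer R₂) (fuel : ℕ) :
    ∀ (m : ℕ) {W : WeierstrassCurve R₁} {W' : WeierstrassCurve R₂}
      {E : WeierstrassCurve.VariableChange R₂},
      W' = E • W.map f → E.u = 1 →
      uniformizer R₁ ∣ W.a₁ → uniformizer R₁ ∣ W.a₂ → ¬ uniformizer R₁ ^ 2 ∣ W.a₂ →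
      uniformizer R₁ ^ (m + 2) ∣ W.a₃ → uniformizer R₁ ^ (m + 3) ∣ W.a₄ →
      uniformizer R₁ ^ (2 * m + 4) ∣ W.a₆ →
      uniformizer R₂ ∣ W'.a₁ → uniformizer R₂ ∣ W'.a₂ → ¬ uniformizer R₂ ^ 2 ∣ W'.a₂ →
      uniformizer R₂ ^ (m + 2) ∣ W'.a₃ → uniformizer R₂ ^ (m + 3) ∣ W'.a₄ →
      uniformizer R₂ ^ (2 * m + 4) ∣ W'.a₆ →
      istarIndexAux fuel m W' = istarIndexAux fuel m W := by
  classical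
  induction fuel with
  | zero => intros; rw [istarIndexAux_zero, istarIndexAux_zero]
  | succ fuel ih =>
    intro m W W' E hrel hu h1 h2 h2n h3 h4 h6 h1' h2' h2n' h3' h4' h6'
    rw [istarIndexAux_succ, istarIndexAux_succ]
    -- the image of the `R₁`-model and rigidity of `E`
    have v1 : uniformizer R₂ ∣ (W.map f).a₁ := by
      rw [WeierstrassCurve.map_a₁, dvd_hom_iff f hw]; exact h1
    have v2 : uniformizer R₂ ∣ (W.map f).a₂ := by
      rw [WeierstrassCurve.map_a₂, dvd_hom_iff f hw]; exact h2
    have v2n : ¬ uniformizer R₂ ^ 2 ∣ (W.map f).a₂ := by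
      rw [WeierstrassCurve.map_a₂, pow_dvd_hom_iff f hw]; exact h2n
    have v3 : uniformizer R₂ ^ (m + 2) ∣ (W.map f).a₃ := by
      rw [WeierstrassCurve.map_a₃, pow_dvd_hom_iff f hw]; exact h3
    have v4 : uniformizer R₂ ^ (m + 3) ∣ (W.map f).a₄ := by
      rw [WeierstrassCurve.map_a₄, pow_dvd_hom_iff f hw]; exact h4
    have v6 : uniformizer R₂ ^ (2 * m + 4) ∣ (W.map f).a₆ := by
      rw [WeierstrassCurve.map_a₆, pow_dvd_hom_iff f hw]; exact h6
    rw [hrel] at h1' h2' h2n' h3' h4' h6'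
    obtain ⟨hr, hs, ht⟩ := dvd_r_s_t_of_step7 hu v1 v2 v2n v3 v4 v6 h1' h2' h3' h4' h6'
    -- first test
    have iffA : distinctRootCount (X ^ 2 + C (redCoeff (E • W.map f).a₃ (m + 2)) * X
        - C (redCoeff (E • W.map f).a₆ (2 * m + 4))) = 2 ↔
        distinctRootCount (X ^ 2 + C (redCoeff W.a₃ (m + 2)) * X
        - C (redCoeff W.a₆ (2 * m + 4))) = 2 := by
      rw [distinctRootCount_quadratic₁_smul hu v1 v2 v3 v4 v6 hr hs ht,
        distinctRootCount_quadratic₁_hom f hw W m]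
    rw [hrel]
    by_cases hA : distinctRootCount (X ^ 2 + C (redCoeff W.a₃ (m + 2)) * X
        - C (redCoeff W.a₆ (2 * m + 4))) = 2
    · rw [if_pos hA, if_pos (iffA.mpr hA)]
    have hA' := fun h => hA (iffA.mp h)
    rw [if_neg hA, if_neg hA']
    -- the `y`-translations exist on both sides
    have hexA := exists_normalize_istarA h1 h2 h3 h4 h6 hA
    have hexA' := exists_normalize_istarA h1' h2' h3' h4' h6' hA'
    rw [dif_pos hexA, dif_pos hexA']
    simp only []
    obtain ⟨k1, k2, k2n, k3, k4, k6⟩ := istarA_spec h1 h2 h2n h3 h4 h6 hexA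
    obtain ⟨k1', k2', k2n', k3', k4', k6'⟩ := istarA_spec h1' h2' h2n' h3' h4' h6' hexA'
    set W₁ := hexA.choose • W with hW₁
    set W₁' := hexA'.choose • (E • W.map f) with hW₁'
    -- coupling of the translated models
    have hrel₁ : W₁' = (hexA'.choose * E * (hexA.choose.map f)⁻¹) •
        W₁.map f := smul_hom_eq_conj_smul f rfl hW₁ hW₁'
    have hu₁ : (hexA'.choose * E * (hexA.choose.map f)⁻¹).u = 1 :=
      conj_hom_u_eq_one f hexA'.choose_spec.1 hu hexA.choose_spec.1
    set E₁ := hexA'.choose * E * (hexA.choose.map f)⁻¹ with hE₁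
    clear_value W₁ W₁' E₁
    have x1 : uniformizer R₂ ∣ (W₁.map f).a₁ := by
      rw [WeierstrassCurve.map_a₁, dvd_hom_iff f hw]; exact k1
    have x2 : uniformizer R₂ ∣ (W₁.map f).a₂ := by
      rw [WeierstrassCurve.map_a₂, dvd_hom_iff f hw]; exact k2
    have x2n : ¬ uniformizer R₂ ^ 2 ∣ (W₁.map f).a₂ := by
      rw [WeierstrassCurve.map_a₂, pow_dvd_hom_iff f hw]; exact k2n
    have x3 : uniformizer R₂ ^ (m + 3) ∣ (W₁.map f).a₃ := by
      rw [WeierstrassCurve.map_a₃, pow_dvd_hom_iff f hw]; exact k3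
    have x4 : uniformizer R₂ ^ (m + 3) ∣ (W₁.map f).a₄ := by
      rw [WeierstrassCurve.map_a₄, pow_dvd_hom_iff f hw]; exact k4
    have x6 : uniformizer R₂ ^ (2 * m + 5) ∣ (W₁.map f).a₆ := by
      rw [WeierstrassCurve.map_a₆, pow_dvd_hom_iff f hw]; exact k6
    rw [hrel₁] at k1' k2' k2n' k3' k4' k6'
    obtain ⟨hr₁, hs₁, ht₁⟩ := dvd_r_s_t_of_step7b hu₁ x1 x2 x2n x3 x4 x6 k1' k2' k3' k4' k6'
    -- second test
    have iffB : distinctRootCount (C (redCoeff (E₁ • W₁.map f).a₂ 1) * X ^ 2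
        + C (redCoeff (E₁ • W₁.map f).a₄ (m + 3)) * X
        + C (redCoeff (E₁ • W₁.map f).a₆ (2 * m + 5))) = 2 ↔
        distinctRootCount (C (redCoeff W₁.a₂ 1) * X ^ 2 + C (redCoeff W₁.a₄ (m + 3)) * X
        + C (redCoeff W₁.a₆ (2 * m + 5))) = 2 := by
      rw [distinctRootCount_quadratic₂_smul hu₁ x1 x2 x3 x4 x6 hr₁ hs₁ ht₁,
        distinctRootCount_quadratic₂_hom f hw W₁ m]
    rw [hrel₁]
    by_cases hB : distinctRootCount (C (redCoeff W₁.a₂ 1) * X ^ 2 + C (redCoeff W₁.a₄ (m + 3)) * X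
        + C (redCoeff W₁.a₆ (2 * m + 5))) = 2
    · rw [if_pos hB, if_pos (iffB.mpr hB)]
    have hB' := fun h => hB (iffB.mp h)
    rw [if_neg hB, if_neg hB']
    -- the `x`-translations exist on both sides
    have hexB := exists_normalize_istarB k1 k2 k2n k3 k4 k6 hB
    have hexB' := exists_normalize_istarB k1' k2' k2n' k3' k4' k6' hB'
    rw [dif_pos hexB, dif_pos hexB']
    obtain ⟨j1, j2, j2n, j3, j4, j6⟩ := istarB_spec k1 k2 k2n k3 k4 k6 hexB
    obtain ⟨j1', j2', j2n', j3', j4', j6'⟩ := istarB_spec k1' k2' k2n' k3' k4' k6' hexB'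
    have hrel₂ : hexB'.choose • (E₁ • W₁.map f) =
        (hexB'.choose * E₁ * (hexB.choose.map f)⁻¹) •
          (hexB.choose • W₁).map f :=
      smul_hom_eq_conj_smul f rfl rfl rfl
    exact ih (m + 1) hrel₂ (conj_hom_u_eq_one f hexB'.choose_spec.1 hu₁ hexB.choose_spec.1)
      j1 j2 j2n j3 j4 j6 j1' j2' j2n' j3' j4' j6'

/-- **`istarIndex` across `f`**: for a step-6 normalised `W` over `R₁` and a step-6 normalised
`W' = E • f W` over `R₂` (`E` with `u = 1`) whose cubics have exactly two distinct roots, the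
initial `x`-translations exist on both sides (perfect residue fields), the translated models
satisfy `π ∥ a₂`, and `istarIndexAux_map_eq` applies with the common fuel `ord Δ`.
Silverman ATAEC IV.9.4, Step 7. [cite: SilvermanATAEC1994, IV.9.4 Step 7] -/
theorem istarIndex_hom_eq [PerfectField (ResidueField R₁)] [PerfectField (ResidueField R₂)]
    (hw : f (uniformizer R₁) = ↑w * uniformizer R₂) {W : WeierstrassCurve R₁}
    {W' : WeierstrassCurve R₂} {E : WeierstrassCurve.VariableChange R₂}
    (hrel : W' = E • W.map f) (hu : E.u = 1)
    (h1 : uniformizer R₁ ∣ W.a₁) (h2 : uniformizer R₁ ∣ W.a₂) (h3 : uniformizer R₁ ^ 2 ∣ W.a₃)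
    (h4 : uniformizer R₁ ^ 2 ∣ W.a₄) (h6 : uniformizer R₁ ^ 3 ∣ W.a₆)
    (h1' : uniformizer R₂ ∣ W'.a₁) (h2' : uniformizer R₂ ∣ W'.a₂)
    (h3' : uniformizer R₂ ^ 2 ∣ W'.a₃) (h4' : uniformizer R₂ ^ 2 ∣ W'.a₄)
    (h6' : uniformizer R₂ ^ 3 ∣ W'.a₆)
    (h7 : distinctRootCount (cubicStep6 W) = 2) (h7' : distinctRootCount (cubicStep6 W') = 2) :
    istarIndex W' = istarIndex W := by
  classical
  have hex := exists_variableChange_step7_of_dvd h1 h2 h3 h4 h6 h7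
  have hex' := exists_variableChange_step7_of_dvd h1' h2' h3' h4' h6' h7'
  unfold istarIndex
  rw [dif_pos hex, dif_pos hex']
  simp only []
  have hf : (IsDiscreteValuationRing.addVal R₂ W'.Δ).toNat =
      (IsDiscreteValuationRing.addVal R₁ W.Δ).toNat := by
    rw [hrel, addVal_Δ_smul_toNat, addVal_Δ_hom_toNat f hw]
  rw [hf]
  -- specs of the translated models
  obtain ⟨huC, m1, m2, m3, m4, m6⟩ := hex.choose_spec
  have k1 := mem_maximalIdeal_iff_dvd.mp m1
  have k2 := mem_maximalIdeal_iff_dvd.mp m2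
  have k3 := mem_maximalIdeal_pow_iff_dvd.mp m3
  have k4 := mem_maximalIdeal_pow_iff_dvd.mp m4
  have k6 := mem_maximalIdeal_pow_iff_dvd.mp m6
  obtain ⟨huC', m1', m2', m3', m4', m6'⟩ := hex'.choose_spec
  have k1' := mem_maximalIdeal_iff_dvd.mp m1'
  have k2' := mem_maximalIdeal_iff_dvd.mp m2'
  have k3' := mem_maximalIdeal_pow_iff_dvd.mp m3'
  have k4' := mem_maximalIdeal_pow_iff_dvd.mp m4'
  have k6' := mem_maximalIdeal_pow_iff_dvd.mp m6'
  have d23 : uniformizer R₁ ^ 2 ∣ uniformizer R₁ ^ 3 := pow_dvd_pow _ (by norm_num)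
  have d34 : uniformizer R₁ ^ 3 ∣ uniformizer R₁ ^ 4 := pow_dvd_pow _ (by norm_num)
  have d23' : uniformizer R₂ ^ 2 ∣ uniformizer R₂ ^ 3 := pow_dvd_pow _ (by norm_num)
  have d34' : uniformizer R₂ ^ 3 ∣ uniformizer R₂ ^ 4 := pow_dvd_pow _ (by norm_num)
  -- `π ∥ a₂` on the translated models (one ring at a time)
  have k2n : ¬ uniformizer R₁ ^ 2 ∣ (hex.choose • W).a₂ := by
    obtain ⟨hr, hs, ht⟩ := dvd_r_s_t_of_step6 huC h1 h2 h3 h4 h6 k1 k2 k3 (d23.trans k4)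
      (d34.trans k6)
    refine not_sq_dvd_a₂_of_distinctRootCount_eq_two k4 k6 ?_
    rw [distinctRootCount_cubicStep6_smul huC h1 h2 h3 h4 h6 hr hs ht]; exact h7
  have k2n' : ¬ uniformizer R₂ ^ 2 ∣ (hex'.choose • W').a₂ := by
    obtain ⟨hr, hs, ht⟩ := dvd_r_s_t_of_step6 huC' h1' h2' h3' h4' h6' k1' k2' k3'
      (d23'.trans k4') (d34'.trans k6')
    refine not_sq_dvd_a₂_of_distinctRootCount_eq_two k4' k6' ?_
    rw [distinctRootCount_cubicStep6_smul huC' h1' h2' h3' h4' h6' hr hs ht]; exact h7'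
  have hrel₇ : hex'.choose • W' =
      (hex'.choose * E * (hex.choose.map f)⁻¹) •
        (hex.choose • W).map f :=
    smul_hom_eq_conj_smul f hrel rfl rfl
  exact istarIndexAux_hom_eq f hw _ 0 hrel₇ (conj_hom_u_eq_one f huC' hu huC) k1 k2 k2n k3 k4 k6
    k1' k2' k2n' k3' k4' k6'

end Coupling

end Unramified

end TateAlgorithm

end Literature.NumberTheory.DiophantineGeometry
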